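import Literature.AlgebraicGeometry.Frobenioids.PadicFrobenioidLogpDivisorTransport
import Literature.AlgebraicGeometry.Frobenioids.PadicFrobenioidUnitSplittings
import HarnessLib

/-!
# Frobenioids II, Theorem 1.2 (v) / Remark 1.2.2 under a self-equivalence: transport of the characteristic
# splitting `τ_p` reduces to transport of the rational function `p`

Mochizuki, *The geometry of Frobenioids II*, Kyushu J. Math. **62** (2008) 401–460, §1, Theorem 1.2 (v) p. 9
("the element `p ∈ ℚ_p^×` determines a characteristic splitting `τ_p` on `C^⊢`") and Remark 1.2.2 p. 10 (the
twisted splittings `u_D · τ_p` — "a situation which, of course, never arises in conventional scheme theory")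
[cite: MochizukiFrdII2008, Thm 1.2 (v) p.9] [cite: MochizukiFrdII2008, Rmk 1.2.2 p.10]; Mochizuki, *The geometry of
Frobenioids I*, Kyushu J. Math. **62** (2008), Corollary 4.11 (ii)–(iv) p. 92 (`Ψ^Base`, `η`, Frobenius degrees
preserved) [cite: MochizukiFrdI2008, Cor. 4.11 (iv) p.92].  Consumed by [IUTchI] Example 3.3 (iii) (e) ("one may
reconstruct the split Frobenioids `F⊢_v`, `F^Θ_v` category-theoretically from `F̲_v`").

PROOF-ONLY file (abc-iut cell, seat abc-iut-L5-t16 gen 7; row E33iii/e «hfix at the genuine datum», piece (F2)),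
0 definitions, no new `Prop`.  For a `p`-adic Frobenioid datum `d` (Example 1.1 (ii)) and a self-equivalence `Ψ` of its
model Frobenioid equipped with base data `(Ψ^Base, η)` and preserving Frobenius degrees ([FrdI] Cor. 4.11 (iv); for slim
bases of FSM-type these are THEOREMS of the tree, `PadicFrd.exists_cor411iv_data_padic`):
* §1 `map_mem_endSubmonoid_iff` — `Ψ` preserves AND reflects the base-identity linear endomorphisms `O^▷(A)`
  (`Base(Ψ w) = η⁻¹ ≫ Ψ^Base(Base w) ≫ η`, and `Ψ^Base` is faithful);
* §2 `map_pSplittingSubmonoid_eq_of_units` — **`Ψ` carries `τ_p(A)` onto `τ_p(Ψ A)` for every `A` as soon as, on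
  `O^▷(A)`, "rational function `= p^m`" is preserved and reflected by `Ψ`** (the hypothesis `H`; at the genuine datum of
  [IUTchI] Ex. 3.3 it is the Kummer-theoretic content of clause (e), at the degenerate one-object base it FAILS — the
  [FrdII] Rmk. 1.2.2 twist, `not_splitFromF_ofKitQp`);
* §3 the bookkeeping the consumer needs to establish `H`: restriction of `O^▷(−)` along LINEAR morphisms multiplies
  rational functions by the field homomorphism of the base arrow (`unit_eq_mapB_of_comp_eq`, `resK_unit_eq_of_comp_eq`)
  and is transported by `Ψ` (`resK_unit_map_eq_of_comp_eq`); `O^▷(A) → K_A^×`, `w ↦ u_w|_{K^×}` is injective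
  (`eq_of_mem_of_resK_unit_eq`) and, under (INT) "`ord(O^▷) ⊆ Φ`", hits every element of `O^▷_{K_A}`
  (`exists_mem_endSubmonoid_resK_unit_eq`); invertible elements of `O^▷(A)` are exactly those with unit rational
  function and `Ψ` preserves them (`isUnit_iff_resK_unit_mem_unitSubgroup`, `resK_unit_map_mem_unitSubgroup_iff`);
  and — Div transport, [FrdI] Cor. 4.11 (iv) via abc-iut-L1-t4's `ιHom_div_map_eq_primGen_pow` — an element of
  `O^▷(A)` with rational function `p` goes to one with rational function `p · (unit)` (`resK_unit_map_div_primeUnit_mem`).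
No statement of either paper is strengthened; nothing here bears on [IUTchIII] Cor. 3.12.
-/

noncomputable section

namespace Literature.AlgebraicGeometry.Frobenioids

namespace PadicFrd

namespace Datum

open CategoryTheory Opposite Function ValuativeRel

universe v u

variable {D : Type u} [Category.{v} D] {p : ℕ} [Fact p.Prime] (d : Datum D p)

/-! ### §1 An equivalence with base data preserves and reflects `O^▷(−)` -/

section BaseData

variable (Ψ : d.frobenioid ≌ d.frobenioid) (ΨBase : D ⥤ D)
  (η : Ψ.functor ⋙ (ModelFrobenioid.data d.Φ d.B d.divB).base ≅ (ModelFrobenioid.data d.Φ d.B d.divB).base ⋙ ΨBase)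
  (hdeg : ∀ ⦃X Y : d.frobenioid⦄ (φ : X ⟶ Y), ModelFrobenioid.degFr (Ψ.functor.map φ) = ModelFrobenioid.degFr φ)

/-- Naturality of `η : Base ∘ Ψ ≅ Ψ^Base ∘ Base` on an arrow: `Base(Ψ φ) ≫ η_Y = η_X ≫ Ψ^Base(Base φ)`.
[cite: MochizukiFrdI2008, Cor. 4.11 (iv) p.92] -/
theorem baseMap_map_comp_eta {X Y : d.frobenioid} (φ : X ⟶ Y) :
    ModelFrobenioid.baseMap (Ψ.functor.map φ) ≫ (η.hom.app Y : (Ψ.functor.obj Y).base ⟶ ΨBase.obj Y.base) =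
      (η.hom.app X : (Ψ.functor.obj X).base ⟶ ΨBase.obj X.base) ≫ ΨBase.map (ModelFrobenioid.baseMap φ) :=
  η.hom.naturality φ

include η in
/-- `Ψ` preserves and (for `Ψ^Base` faithful) reflects base-identity arrows: `Base(Ψ w) = id ↔ Base(w) = id`.
[cite: MochizukiFrdI2008, Cor. 4.11 (iv) p.92] -/
theorem baseMap_map_eq_id_iff [ΨBase.Faithful] {X : d.frobenioid} (w : X ⟶ X) :
    ModelFrobenioid.baseMap (Ψ.functor.map w) = 𝟙 _ ↔ ModelFrobenioid.baseMap w = 𝟙 _ := by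
  -- the component of `η` at `X`, with clean source and target
  let i : (Ψ.functor.obj X).base ≅ ΨBase.obj X.base := η.app X
  have hnat : ModelFrobenioid.baseMap (Ψ.functor.map w) ≫ i.hom = i.hom ≫ ΨBase.map (ModelFrobenioid.baseMap w) :=
    η.hom.naturality w
  constructor
  · intro h
    rw [h, Category.id_comp] at hnat
    have h2 : ΨBase.map (ModelFrobenioid.baseMap w) = 𝟙 _ :=
      ((cancel_epi i.hom).1 (hnat.symm.trans (Category.comp_id _).symm))
    exact ΨBase.map_injective (h2.trans (ΨBase.map_id _).symm)
  · intro h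
    have h1 : ΨBase.map (ModelFrobenioid.baseMap w) = 𝟙 _ := by rw [h, ΨBase.map_id]
    rw [h1, Category.comp_id] at hnat
    exact (cancel_mono i.hom).1 (hnat.trans (Category.id_comp _).symm)

include hdeg in
/-- `Ψ` preserves and reflects linear arrows. [cite: MochizukiFrdI2008, Cor. 4.11 (iv) p.92] -/
theorem isLinear_map_iff {X Y : d.frobenioid} (φ : X ⟶ Y) :
    PreFrobenioid.IsLinear d.structureFunctor (Ψ.functor.map φ) ↔ PreFrobenioid.IsLinear d.structureFunctor φ := by
  change ModelFrobenioid.degFr (Ψ.functor.map φ) = 1 ↔ ModelFrobenioid.degFr φ = 1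
  rw [hdeg φ]

include η hdeg in
/-- **`Ψ` carries `O^▷(A)` onto `O^▷(Ψ A)`**: a `w : A → A` is a base-identity linear endomorphism iff `Ψ w` is.
[cite: MochizukiFrdI2008, Cor. 4.11 (iv) p.92] -/
theorem map_mem_endSubmonoid_iff [ΨBase.Faithful] {X : d.frobenioid} (w : X ⟶ X) :
    Ψ.functor.map w ∈ PreFrobenioid.endSubmonoid d.structureFunctor (Ψ.functor.obj X) ↔
      w ∈ PreFrobenioid.endSubmonoid d.structureFunctor X := by
  change (ModelFrobenioid.baseMap (Ψ.functor.map w) = 𝟙 _ ∧ ModelFrobenioid.degFr (Ψ.functor.map w) = 1) ↔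
    (ModelFrobenioid.baseMap w = 𝟙 _ ∧ ModelFrobenioid.degFr w = 1)
  rw [baseMap_map_eq_id_iff d Ψ ΨBase η w, hdeg w]

/-! ### §2 `τ_p` is carried onto `τ_p` as soon as the rational function `p` is -/

include η hdeg in
/-- **Transport of `τ_p` reduces to transport of the rational function `p^m`.**  If on base-identity linear
endomorphisms `Ψ` preserves and reflects "the rational function restricted to `K^×` is `p^m`" (hypothesis `H`), then
`Ψ` carries the characteristic splitting `τ_p(A)` ([FrdII] Thm. 1.2 (v)) onto `τ_p(Ψ A)` for every object `A` — the
form `σ.IsPreservedBy σ Ψ` (`σ = ⟨τ_p⟩`) consumed by [IUTchI] Ex. 3.3 (iii) (e).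
[cite: MochizukiFrdII2008, Thm 1.2 (v) p.9] -/
theorem map_pSplittingSubmonoid_eq_of_units [ΨBase.Faithful]
    (H : ∀ (X : d.frobenioid) (w : X ⟶ X), w ∈ PreFrobenioid.endSubmonoid d.structureFunctor X → ∀ m : ℕ,
      d.resK X.base (ModelFrobenioid.unit w) = d.primeUnit X.base ^ m ↔
        d.resK (Ψ.functor.obj X).base (ModelFrobenioid.unit (Ψ.functor.map w)) =
          d.primeUnit (Ψ.functor.obj X).base ^ m)
    (X : d.frobenioid) :
    (d.pSplittingSubmonoid X).map (Ψ.functor.mapEnd X) = d.pSplittingSubmonoid (Ψ.functor.obj X) := by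
  ext w'
  constructor
  · rintro ⟨w, ⟨hw, m, hm⟩, rfl⟩
    exact ⟨(map_mem_endSubmonoid_iff d Ψ ΨBase η hdeg w).mpr hw, m, (H X w hw m).mp hm⟩
  · rintro ⟨hw', m, hm'⟩
    have hpre : Ψ.functor.map (Ψ.functor.preimage (End.asHom w')) = End.asHom w' := Ψ.functor.map_preimage _
    have hw : Ψ.functor.preimage (End.asHom w') ∈ PreFrobenioid.endSubmonoid d.structureFunctor X :=
      (map_mem_endSubmonoid_iff d Ψ ΨBase η hdeg _).mp (by rw [hpre]; exact hw')
    refine ⟨Ψ.functor.preimage (End.asHom w'), ⟨hw, m, (H X _ hw m).mpr ?_⟩, hpre⟩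
    rw [hpre]
    exact hm'

end BaseData

/-! ### §3 Bookkeeping on `O^▷(−)`: rational functions along linear morphisms, injectivity, surjectivity, units -/

/-- **Restriction along a linear morphism multiplies rational functions by the base arrow**: if `φ : A → B` is
linear, `β ∈ O^▷(B)`, `α ∈ O^▷(A)` and `β ∘ φ = φ ∘ α`, then `u_α = B(Base φ)(u_β)` ([FrdI] Def. 2.3 subfunctoriality,
as in the proof of `mem_pSplittingSubmonoid_of_comp_eq`). [cite: MochizukiFrdII2008, Thm 1.2 (v) p.10] -/
theorem unit_eq_mapB_of_comp_eq {X Y : d.frobenioid} (φ : X ⟶ Y) (hφ : PreFrobenioid.IsLinear d.structureFunctor φ)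
    {β : Y ⟶ Y} (hβ : β ∈ PreFrobenioid.endSubmonoid d.structureFunctor Y) {α : X ⟶ X}
    (hα : α ∈ PreFrobenioid.endSubmonoid d.structureFunctor X) (h : φ ≫ β = α ≫ φ) :
    ModelFrobenioid.unit α = (d.B.map (ModelFrobenioid.baseMap φ).op).hom (ModelFrobenioid.unit β) := by
  have hu := congrArg ModelFrobenioid.unit h
  have hdφ : ModelFrobenioid.degFr φ = 1 := hφ
  have hdβ : ModelFrobenioid.degFr β = 1 := hβ.2
  have hbα : ModelFrobenioid.baseMap α = 𝟙 X.base := hα.1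
  rw [ModelFrobenioid.unit_comp, ModelFrobenioid.unit_comp, hdφ, hdβ, hbα, PNat.one_coe, pow_one,
    pow_one, ModelFrobenioid.map_id_apply_B, mul_comm (ModelFrobenioid.unit φ) (ModelFrobenioid.unit α)] at hu
  obtain ⟨c, hc⟩ := d.isUnit_B (op X.base) (ModelFrobenioid.unit φ)
  rw [← hc] at hu
  exact ((Units.mul_left_inj c).mp hu).symm

/-- The same, restricted to `K^×`: `u_α|_{K_A^×} = σ_φ(u_β|_{K_B^×})`, `σ_φ : K_B → K_A` the field homomorphism
under `Base(φ)`. [cite: MochizukiFrdII2008, Thm 1.2 (v) p.10] -/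
theorem resK_unit_eq_of_comp_eq {X Y : d.frobenioid} (φ : X ⟶ Y) (hφ : PreFrobenioid.IsLinear d.structureFunctor φ)
    {β : Y ⟶ Y} (hβ : β ∈ PreFrobenioid.endSubmonoid d.structureFunctor Y) {α : X ⟶ X}
    (hα : α ∈ PreFrobenioid.endSubmonoid d.structureFunctor X) (h : φ ≫ β = α ≫ φ) :
    d.resK X.base (ModelFrobenioid.unit α) =
      Units.map ((d.base.map (ModelFrobenioid.baseMap φ)).alg : d.fld Y.base →* d.fld X.base)
        (d.resK Y.base (ModelFrobenioid.unit β)) := by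
  rw [d.unit_eq_mapB_of_comp_eq φ hφ hβ hα h, d.resK_mapB]

section Transported

variable (Ψ : d.frobenioid ≌ d.frobenioid) (ΨBase : D ⥤ D)
  (η : Ψ.functor ⋙ (ModelFrobenioid.data d.Φ d.B d.divB).base ≅ (ModelFrobenioid.data d.Φ d.B d.divB).base ⋙ ΨBase)
  (hdeg : ∀ ⦃X Y : d.frobenioid⦄ (φ : X ⟶ Y), ModelFrobenioid.degFr (Ψ.functor.map φ) = ModelFrobenioid.degFr φ)

include η hdeg in
/-- **Naturality of the unit transport**: in the situation of `resK_unit_eq_of_comp_eq`, the rational functions of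
`Ψ α` and `Ψ β` are related by the field homomorphism under `Base(Ψ φ)` (functoriality of `Ψ`, which preserves
linearity and `O^▷(−)`). [cite: MochizukiFrdI2008, Cor. 4.11 (iv) p.92] -/
theorem resK_unit_map_eq_of_comp_eq [ΨBase.Faithful] {X Y : d.frobenioid} (φ : X ⟶ Y)
    (hφ : PreFrobenioid.IsLinear d.structureFunctor φ) {β : Y ⟶ Y}
    (hβ : β ∈ PreFrobenioid.endSubmonoid d.structureFunctor Y) {α : X ⟶ X}
    (hα : α ∈ PreFrobenioid.endSubmonoid d.structureFunctor X) (h : φ ≫ β = α ≫ φ) :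
    d.resK (Ψ.functor.obj X).base (ModelFrobenioid.unit (Ψ.functor.map α)) =
      Units.map ((d.base.map (ModelFrobenioid.baseMap (Ψ.functor.map φ))).alg :
          d.fld (Ψ.functor.obj Y).base →* d.fld (Ψ.functor.obj X).base)
        (d.resK (Ψ.functor.obj Y).base (ModelFrobenioid.unit (Ψ.functor.map β))) :=
  d.resK_unit_eq_of_comp_eq (Ψ.functor.map φ) ((isLinear_map_iff d Ψ hdeg φ).mpr hφ)
    ((map_mem_endSubmonoid_iff d Ψ ΨBase η hdeg β).mpr hβ) ((map_mem_endSubmonoid_iff d Ψ ΨBase η hdeg α).mpr hα)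
    (by rw [← Functor.map_comp, h, Functor.map_comp])

end Transported

/-- `B(A) → K_A^×` is injective (the second component `Div_B` of the fibre product is recovered from the first
through the injective `ι^gp`). [cite: MochizukiFrdII2008, Ex 1.1 (ii) p.8] -/
theorem resK_injective (A : D) : Injective (d.resK A) := by
  intro u u' h
  haveI := isCancelMul_realification (OrdInt (d.fld A))
  have hι : Injective (MonGp.map (d.ιHom A)) := MonGp.map_injective _ (d.ιHom_injective A)
  refine d.resK_ext A h (hι ?_)
  rw [← d.divZeroHom_resK, ← d.divZeroHom_resK, h]

/-- **`O^▷(A) → K_A^×`, `w ↦ u_w|_{K^×}`, is injective**: a base-identity linear endomorphism is determined by the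
restriction of its rational function to `K_A^×`. [cite: MochizukiFrdII2008, Thm 1.2 (v) p.10] -/
theorem eq_of_mem_of_resK_unit_eq {X : d.frobenioid} {e e' : X ⟶ X}
    (he : e ∈ PreFrobenioid.endSubmonoid d.structureFunctor X)
    (he' : e' ∈ PreFrobenioid.endSubmonoid d.structureFunctor X)
    (h : d.resK X.base (ModelFrobenioid.unit e) = d.resK X.base (ModelFrobenioid.unit e')) : e = e' :=
  d.eq_of_mem_of_unit_eq he he' (d.resK_injective X.base h)

/-- **Under (INT) every element of `O^▷_{K_A}` is a rational function**: if `ord(O^▷_{K_A}) ⊗ 1 ⊆ Φ(A)` (e.g. the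
perfection datum `Φ = ord(O^▷)^pf` of [IUTchI] Ex. 3.3, `Datum.perf_exists_ιHom_eq`), then for every `x ∈ O^▷_{K_A}`
there is `w ∈ O^▷(A)` with `u_w|_{K^×} = x` (namely `(1, id, ord(x) ⊗ 1, (x, ord x))`).
[cite: MochizukiFrdII2008, Ex 1.1 (ii) p.8] -/
theorem exists_mem_endSubmonoid_resK_unit_eq
    (hint : ∀ (A : D) (a : OrdInt (d.fld A)), ∃ c : d.Φ.obj (op A), d.ιHom A c = Realification.of _ a)
    (X : d.frobenioid) (x : intNonzero (d.fld X.base)) :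
    ∃ w : X ⟶ X, w ∈ PreFrobenioid.endSubmonoid d.structureFunctor X ∧
      d.resK X.base (ModelFrobenioid.unit w) = intNonzeroToUnits _ x := by
  obtain ⟨c, hc⟩ := hint X.base (Associates.mk x)
  obtain ⟨u, hu₁, hu₂⟩ := d.exists_B_of_compat (op X.base) (intNonzeroToUnits _ x)
    (Algebra.GrothendieckGroup.of c) (by
      rw [divZeroHom_intNonzeroToUnits, MonGp.map_of]
      exact congrArg Algebra.GrothendieckGroup.of hc.symm)
  exact ⟨ModelFrobenioid.unitEnd X c u hu₂.symm, d.unitEnd_mem_endSubmonoid X c u hu₂.symm, hu₁⟩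

/-- **Invertible elements of `O^▷(A)` are those with unit rational function**: `w ∈ O^▷(A)` has a two-sided inverse
in `O^▷(A)` iff `v(u_w|_{K^×}) = 1` (⇒: `resK_unit_mem_unitSubgroup_of_isUnit`; ⇐: the endomorphism over `u_w⁻¹`,
which lies in `B(A)` over the trivial divisor, is the inverse). [cite: MochizukiFrdII2008, Thm 1.2 (i) p.9] -/
theorem isUnit_iff_resK_unit_mem_unitSubgroup {X : d.frobenioid}
    (w : PreFrobenioid.endSubmonoid d.structureFunctor X) :
    IsUnit w ↔ d.resK X.base (ModelFrobenioid.unit (End.asHom (w : End X))) ∈ unitSubgroup (d.fld X.base) := by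
  refine ⟨fun hw => d.resK_unit_mem_unitSubgroup_of_isUnit hw, fun hw => ?_⟩
  -- the inverse: the base-identity linear endomorphism over `u_w⁻¹`
  obtain ⟨u, hu₁, hu₂⟩ := d.exists_B_over_unit (op X.base)
    (d.resK X.base (ModelFrobenioid.unit (End.asHom (w : End X))))⁻¹ (Subgroup.inv_mem _ hw)
  have hrel : Algebra.GrothendieckGroup.of (1 : d.Φ.obj (op X.base)) = Frobenioids.divB d.Φ d.B d.divB (op X.base) u := by
    rw [map_one, hu₂]
  let w' : X ⟶ X := ModelFrobenioid.unitEnd X 1 u hrel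
  have hw' : w' ∈ PreFrobenioid.endSubmonoid d.structureFunctor X := d.unitEnd_mem_endSubmonoid X 1 u hrel
  have hres : d.resK X.base (ModelFrobenioid.unit w') = (d.resK X.base (ModelFrobenioid.unit (End.asHom (w : End X))))⁻¹ :=
    hu₁
  have hm₁ : (End.of w' * (w : End X)) ∈ PreFrobenioid.endSubmonoid d.structureFunctor X :=
    Submonoid.mul_mem _ hw' w.2
  have hm₂ : ((w : End X) * End.of w') ∈ PreFrobenioid.endSubmonoid d.structureFunctor X :=
    Submonoid.mul_mem _ w.2 hw'
  have h₁ : End.asHom (w : End X) ≫ w' = 𝟙 X := by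
    refine d.eq_id_of_resK_unit_eq_one hm₁ ?_
    change d.resK X.base (ModelFrobenioid.unit (End.asHom (w : End X) ≫ w')) = 1
    rw [d.unit_comp_of_mem hw' w.2, map_mul, hres, inv_mul_cancel]
  have h₂ : w' ≫ End.asHom (w : End X) = 𝟙 X := by
    refine d.eq_id_of_resK_unit_eq_one hm₂ ?_
    change d.resK X.base (ModelFrobenioid.unit (w' ≫ End.asHom (w : End X))) = 1
    rw [d.unit_comp_of_mem w.2 hw', map_mul, hres, mul_inv_cancel]
  refine ⟨⟨w, ⟨End.of w', hw'⟩, Subtype.ext h₂, Subtype.ext h₁⟩, rfl⟩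

section Units

variable (Ψ : d.frobenioid ≌ d.frobenioid) (ΨBase : D ⥤ D)
  (η : Ψ.functor ⋙ (ModelFrobenioid.data d.Φ d.B d.divB).base ≅ (ModelFrobenioid.data d.Φ d.B d.divB).base ⋙ ΨBase)
  (hdeg : ∀ ⦃X Y : d.frobenioid⦄ (φ : X ⟶ Y), ModelFrobenioid.degFr (Ψ.functor.map φ) = ModelFrobenioid.degFr φ)

include η hdeg in
/-- **`Ψ` preserves and reflects "unit rational function" on `O^▷(−)`**: `Ψ` restricts to an isomorphism of monoids
`O^▷(A) ⥲ O^▷(Ψ A)`, so it respects invertibility, which is "`v(u|_{K^×}) = 1`" on both sides.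
[cite: MochizukiFrdII2008, Thm 1.2 (i) p.9] -/
theorem resK_unit_map_mem_unitSubgroup_iff [ΨBase.Faithful] {X : d.frobenioid} {w : X ⟶ X}
    (hw : w ∈ PreFrobenioid.endSubmonoid d.structureFunctor X) :
    d.resK (Ψ.functor.obj X).base (ModelFrobenioid.unit (Ψ.functor.map w)) ∈ unitSubgroup (d.fld (Ψ.functor.obj X).base) ↔
      d.resK X.base (ModelFrobenioid.unit w) ∈ unitSubgroup (d.fld X.base) := by
  have hΨw : Ψ.functor.map w ∈ PreFrobenioid.endSubmonoid d.structureFunctor (Ψ.functor.obj X) :=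
    (map_mem_endSubmonoid_iff d Ψ ΨBase η hdeg w).mpr hw
  have key : IsUnit (⟨End.of (Ψ.functor.map w), hΨw⟩ : PreFrobenioid.endSubmonoid d.structureFunctor (Ψ.functor.obj X)) ↔
      IsUnit (⟨End.of w, hw⟩ : PreFrobenioid.endSubmonoid d.structureFunctor X) := by
    constructor
    · rintro ⟨⟨_, ⟨v', hv'⟩, h₁, h₂⟩, rfl⟩
      -- pull the inverse back along the full `Ψ`
      have hpre : Ψ.functor.map (Ψ.functor.preimage (End.asHom v')) = End.asHom v' := Ψ.functor.map_preimage _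
      have hv : Ψ.functor.preimage (End.asHom v') ∈ PreFrobenioid.endSubmonoid d.structureFunctor X :=
        (map_mem_endSubmonoid_iff d Ψ ΨBase η hdeg _).mp (by rw [hpre]; exact hv')
      have h₁' := congrArg Subtype.val h₁
      have h₂' := congrArg Subtype.val h₂
      change End.asHom v' ≫ Ψ.functor.map w = 𝟙 _ at h₁'
      change Ψ.functor.map w ≫ End.asHom v' = 𝟙 _ at h₂'
      refine ⟨⟨⟨End.of w, hw⟩, ⟨End.of (Ψ.functor.preimage (End.asHom v')), hv⟩, Subtype.ext ?_, Subtype.ext ?_⟩, rfl⟩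
      · change Ψ.functor.preimage (End.asHom v') ≫ w = 𝟙 X
        exact Ψ.functor.map_injective (by rw [Functor.map_comp, hpre, h₁', CategoryTheory.Functor.map_id])
      · change w ≫ Ψ.functor.preimage (End.asHom v') = 𝟙 X
        exact Ψ.functor.map_injective (by rw [Functor.map_comp, hpre, h₂', CategoryTheory.Functor.map_id])
    · rintro ⟨⟨_, ⟨v', hv'⟩, h₁, h₂⟩, rfl⟩
      have h₁' := congrArg Subtype.val h₁
      have h₂' := congrArg Subtype.val h₂
      change End.asHom v' ≫ w = 𝟙 _ at h₁'
      change w ≫ End.asHom v' = 𝟙 _ at h₂'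
      refine ⟨⟨⟨End.of (Ψ.functor.map w), hΨw⟩,
        ⟨End.of (Ψ.functor.map (End.asHom v')), (map_mem_endSubmonoid_iff d Ψ ΨBase η hdeg _).mpr hv'⟩,
        Subtype.ext ?_, Subtype.ext ?_⟩, rfl⟩
      · change Ψ.functor.map (End.asHom v') ≫ Ψ.functor.map w = 𝟙 _
        rw [← Functor.map_comp, h₁', CategoryTheory.Functor.map_id]
      · change Ψ.functor.map w ≫ Ψ.functor.map (End.asHom v') = 𝟙 _
        rw [← Functor.map_comp, h₂', CategoryTheory.Functor.map_id]
  have h := (d.isUnit_iff_resK_unit_mem_unitSubgroup ⟨End.of (Ψ.functor.map w), hΨw⟩).symm.trans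
    (key.trans (d.isUnit_iff_resK_unit_mem_unitSubgroup ⟨End.of w, hw⟩))
  exact h

end Units

/-! ### §4 The rational function `p` goes to `p · (unit)` (Div transport, [FrdI] Cor. 4.11 (iv)) -/

/-- For `w ∈ O^▷(A)`: `ι(Div w) = ord(p) ⊗ 1` iff `u_w|_{K^×} ∈ p · O_{K_A}^×` (the cartesian square
`Div₀(u|_{K^×}) = ι^gp(Div_B u)`, relation (d) `Div w = Div_B(u_w)`, and `Ker(Div₀) = O_K^×` for a `p`-adic local
field). [cite: MochizukiFrdII2008, Ex 1.1 (ii) p.8] -/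
theorem ιHom_div_eq_primGen_iff {X : d.frobenioid} {w : X ⟶ X}
    (hw : w ∈ PreFrobenioid.endSubmonoid d.structureFunctor X) :
    d.ιHom X.base (ModelFrobenioid.div w) = primGen d.base X.base ↔
      d.resK X.base (ModelFrobenioid.unit w) * (d.primeUnit X.base)⁻¹ ∈ unitSubgroup (d.fld X.base) := by
  obtain ⟨⟨inst, hfin, hc⟩⟩ := d.isPadicLocal X.base
  letI := inst
  haveI := hfin
  haveI := isCancelMul_realification (OrdInt (d.fld X.base))
  have hι : Injective (MonGp.map (d.ιHom X.base)) := MonGp.map_injective _ (d.ιHom_injective X.base)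
  rw [← ker_divZeroHom_eq_unitSubgroup hc, MonoidHom.mem_ker, map_mul, map_inv, mul_inv_eq_one,
    d.divZeroHom_resK, ← d.of_div_eq_divB_unit hw, MonGp.map_of, d.divZeroHom_primeUnit]
  change _ ↔ Algebra.GrothendieckGroup.of (d.ιHom X.base (ModelFrobenioid.div w)) =
    Algebra.GrothendieckGroup.of (primGen d.base X.base)
  exact ⟨fun h => by rw [h], fun h => Algebra.GrothendieckGroup.of_injective h⟩

/-- **The rational function `p` goes to `p · (unit)` under a self-equivalence** of a `p`-adic Frobenioid over a slim
base of FSM-type satisfying (INT) and the ramification clause (γ) (`hram`: the base equivalence preserves the value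
monoids `ord(O^▷)` over `ord(p)`; at [IUTchI] Ex. 3.3's genuine datum a THEOREM): for `w ∈ O^▷(A)` with
`u_w|_{K^×} ∈ p · O^×`, also `u_{Ψ w}|_{K^×} ∈ p · O^×` — [FrdI] Cor. 4.11 (iv) Div transport (abc-iut-L1-t4's
`ιHom_div_map_eq_primGen_pow`). The residual unit is the subject of [IUTchI] Ex. 3.3 (iii) (e).
[cite: MochizukiFrdI2008, Cor. 4.11 (iv) p.92] -/
theorem resK_unit_map_div_primeUnit_mem (hD : IsOfFSMType D) (hsl : IsSlim D) (Ψ : d.frobenioid ≌ d.frobenioid)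
    (hint : ∀ (A : D) (a : OrdInt (d.fld A)), ∃ c : d.Φ.obj (op A), d.ιHom A c = Realification.of _ a)
    (hram : ∀ X : d.frobenioid, ∃ ι : OrdInt (d.fld X.base) ≃* OrdInt (d.fld (Ψ.functor.obj X).base),
      ι (Associates.mk ⟨((p : ℕ) : d.fld X.base), (d.base.obj X.base).p_mem⟩) =
        Associates.mk ⟨((p : ℕ) : d.fld (Ψ.functor.obj X).base), (d.base.obj (Ψ.functor.obj X).base).p_mem⟩)
    (ΨBase : D ⥤ D) [ΨBase.Faithful]
    (η : Ψ.functor ⋙ (ModelFrobenioid.data d.Φ d.B d.divB).base ≅ (ModelFrobenioid.data d.Φ d.B d.divB).base ⋙ ΨBase)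
    (hdeg : ∀ ⦃X Y : d.frobenioid⦄ (φ : X ⟶ Y), ModelFrobenioid.degFr (Ψ.functor.map φ) = ModelFrobenioid.degFr φ)
    {X : d.frobenioid} {w : X ⟶ X} (hw : w ∈ PreFrobenioid.endSubmonoid d.structureFunctor X)
    (hp : d.resK X.base (ModelFrobenioid.unit w) * (d.primeUnit X.base)⁻¹ ∈ unitSubgroup (d.fld X.base)) :
    d.resK (Ψ.functor.obj X).base (ModelFrobenioid.unit (Ψ.functor.map w)) * (d.primeUnit (Ψ.functor.obj X).base)⁻¹ ∈
      unitSubgroup (d.fld (Ψ.functor.obj X).base) := by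
  have hΨw : Ψ.functor.map w ∈ PreFrobenioid.endSubmonoid d.structureFunctor (Ψ.functor.obj X) :=
    (map_mem_endSubmonoid_iff d Ψ ΨBase η hdeg w).mpr hw
  rw [← d.ιHom_div_eq_primGen_iff hΨw]
  have h1 : d.ιHom X.base (ModelFrobenioid.div w) = primGen d.base X.base ^ 1 := by
    rw [pow_one]
    exact (d.ιHom_div_eq_primGen_iff hw).mpr hp
  have h := d.ιHom_div_map_eq_primGen_pow hD hsl Ψ hint hram w 1 h1
  rw [pow_one] at h
  exact h

end Datum

end PadicFrd

end Literature.AlgebraicGeometry.Frobenioids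

end
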